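import Mathlib.Analysis.Calculus.ParametricIntegral
import Mathlib.MeasureTheory.Measure.Prod
import Literature.Barriers.CriticalPhenomena.WeaklySAWFourDimLogCorrectionsReduction
import Literature.Barriers.CriticalPhenomena.WeaklySAWFourDimLogCorrectionsProofs
import HarnessLib

/-!
# `WeaklySAWFourDimLogCorrections` (BBS 2015): the part of Lemma 2.1 used in §4, proved —
# `χ(g, ·)` is finite and differentiable above `ν_c`

Companion to `WeaklySAWFourDimLogCorrectionsReduction.lean` (Bauerschmidt–Brydges–Slade, CMP 337
(2015), arXiv:1403.7422), whose reduction `BBS2015_thm11_of_thm41` consumes the named fact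
`CTWSAW.BBS2015_lem21`: for `d > 0`, `g > 0`, `ν > ν_c(d,g)`, `χ(g,ν) < ∞` and
`ν ↦ χ(g,ν)` is differentiable at `ν` (Lemma 2.1: "`χ` is analytic on `Re ν > ν_c`" —
"analyticity of Laplace transforms"). This file DISCHARGES it: `BBS2015_lem21_holds`.

Proof (the real-variable content of "analyticity of Laplace transforms"): `χ(g,ν) = ∫₀^∞ c_T
e^{-νT} dT` with `0 ≤ c_T ≤ 1` (`survival_le_one` of `…Proofs.lean`) and `T ↦ c_T` measurable
(`measurable_survival`, from the jump-chain formula: the integrand of `pathIntegral` is jointly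
measurable in `(T, s)`, `Measurable.lintegral_prod_right'`, countable sums); finiteness above `ν_c`
is `susceptibility_lt_top_of_criticalNu_lt` (`…Proofs.lean`); as a real function
`χ(g,ν') = ∫_{T>0} c_T e^{-ν'T} dT` (`susceptibility_toReal_eq_integral`), and for
`ν_c < ν₁ < ν` the derivative `-∫ T c_T e^{-ν'T} dT` exists at `ν` by dominated differentiation
(`hasDerivAt_integral_of_dominated_loc_of_deriv_le`) with the dominating function
`η⁻¹ c_T e^{-ν₁T}`, `η = (ν - ν₁)/2`, using `Te^{-ηT} ≤ η⁻¹`.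

Contents (namespace `Literature.Barriers.CriticalPhenomena.CTWSAW`): `continuous_sojourns_apply`,
`continuous_selfIntersection`, `measurable_pathIntegral`, `measurable_survival`,
`susceptibility_toReal_eq_integral`, `hasDerivAt_susceptibility_toReal`, `BBS2015_lem21_holds`.
-/

noncomputable section

open MeasureTheory Filter Topology Set
open Literature.Probability.LatticeModels
open scoped ENNReal BigOperators

namespace Literature.Barriers.CriticalPhenomena

namespace CTWSAW

variable {d : ℕ}

/-! ### Measurability of `T ↦ c_{g,T}` -/

/-- Each sojourn time is a continuous (affine) function of `(T, s)`. [folklore] -/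
theorem continuous_sojourns_apply {k : ℕ} (i : Fin (k + 1)) :
    Continuous fun p : ℝ × (Fin k → ℝ) => sojourns p.1 p.2 i := by
  unfold sojourns
  induction i using Fin.lastCases with
  | last =>
    simp only [Fin.snoc_last]
    exact continuous_fst.sub
      (continuous_finsetSum _ fun j _ => (continuous_apply j).comp continuous_snd)
  | cast j =>
    simp only [Fin.snoc_castSucc]
    exact (continuous_apply j).comp continuous_snd

/-- The self-intersection local time of a fixed skeleton is a continuous (polynomial) function of
`(T, s)`. [folklore] -/
theorem continuous_selfIntersection {x : Site d} (ω : (zdGraph d).Walk 0 x) :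
    Continuous fun p : ℝ × (Fin ω.length → ℝ) => selfIntersection p.1 ω p.2 := by
  unfold selfIntersection
  refine continuous_finsetSum _ fun i _ => continuous_finsetSum _ fun j _ => ?_
  by_cases h : ω.getVert i = ω.getVert j
  · simp only [h, if_true]
    exact (continuous_sojourns_apply i).mul (continuous_sojourns_apply j)
  · simp only [h, if_false]
    exact continuous_const

/-- `T ↦ ∫_{Δ_k(T)} e^{-gI(T)} ds` is measurable (joint measurability of the integrand and of the
sojourn simplex in `(T, s)`, then `Measurable.lintegral_prod_right'`). [folklore] -/
theorem measurable_pathIntegral (g : ℝ) {x : Site d} (ω : (zdGraph d).Walk 0 x) :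
    Measurable fun T => pathIntegral g T ω := by
  set S : Set (ℝ × (Fin ω.length → ℝ)) := {p | p.2 ∈ sojournSet ω.length p.1} with hSdef
  have hS : MeasurableSet S := by
    have h1 : S = (⋂ i, {p : ℝ × (Fin ω.length → ℝ) | 0 < p.2 i}) ∩
        {p | ∑ i, p.2 i < p.1} := by
      ext p
      simp [hSdef, sojournSet]
    rw [h1]
    refine (MeasurableSet.iInter fun i => ?_).inter ?_
    · exact measurableSet_lt measurable_const ((measurable_pi_apply i).comp measurable_snd)
    · exact measurableSet_lt
        (Finset.measurable_sum _ fun i _ => (measurable_pi_apply i).comp measurable_snd)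
        measurable_fst
  set f : ℝ × (Fin ω.length → ℝ) → ℝ≥0∞ :=
    fun p => ENNReal.ofReal (Real.exp (-g * selfIntersection p.1 ω p.2)) with hfdef
  have hf : Measurable f :=
    (Real.continuous_exp.comp (continuous_const.mul (continuous_selfIntersection ω))).measurable
      |>.ennreal_ofReal
  have hF : Measurable fun T => ∫⁻ s, S.indicator f (T, s) := (hf.indicator hS).lintegral_prod_right'
  have heq : (fun T => pathIntegral g T ω) = fun T => ∫⁻ s, S.indicator f (T, s) := by
    funext T
    rw [pathIntegral, ← lintegral_indicator (measurableSet_sojournSet _ _)]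
    congr 1 with s
  rw [heq]
  exact hF

/-- `T ↦ c_{g,T}` is measurable. [folklore] -/
theorem measurable_survival (d : ℕ) (g : ℝ) : Measurable fun T => survival d g T := by
  unfold survival weightedExpectation
  refine Measurable.mul
    ((Real.continuous_exp.comp (continuous_const.mul continuous_id)).measurable.ennreal_ofReal) ?_
  refine Measurable.tsum fun k => ?_
  refine Finset.measurable_sum _ fun x _ => Finset.measurable_sum _ fun ω _ => ?_
  exact (measurable_pathIntegral g ω).const_mul _

/-! ### `χ` as a real Laplace transform and its derivative -/

/-- `χ(g, ν)` as a real number is the Bochner integral `∫_{T>0} c_T e^{-νT} dT` (`g ≥ 0`; both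
sides vanish when `χ = ∞`). [cite: BauerschmidtBrydgesSlade2015LogCorr, §1.1 (susceptibility, eq. (1.3))] -/
theorem susceptibility_toReal_eq_integral {g : ℝ} (hg : 0 ≤ g) (d : ℕ) (ν : ℝ) :
    (susceptibility d g ν).toReal =
      ∫ T in Ioi (0 : ℝ), (survival d g T).toReal * Real.exp (-ν * T) := by
  rw [integral_eq_lintegral_of_nonneg_ae]
  · congr 1
    unfold susceptibility
    refine setLIntegral_congr_fun measurableSet_Ioi fun T hT => ?_
    rw [ENNReal.ofReal_mul ENNReal.toReal_nonneg,
      ENNReal.ofReal_toReal ((survival_le_one hg d hT).trans_lt ENNReal.one_lt_top).ne]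
  · exact Eventually.of_forall fun T => mul_nonneg ENNReal.toReal_nonneg (Real.exp_pos _).le
  · have hm : Measurable fun T => (survival d g T).toReal * Real.exp (-ν * T) :=
      (measurable_survival d g).ennreal_toReal.mul
        (Real.continuous_exp.comp (continuous_const.mul continuous_id)).measurable
    exact hm.aestronglyMeasurable

/-- Integrability of `c_T e^{-νT}` on `(0, ∞)` for `ν > ν_c` (`g ≥ 0`). [cite: BauerschmidtBrydgesSlade2015LogCorr, Lemma A.1 (χ < ∞ above ν_c)] -/
theorem integrableOn_survival_mul_exp {g : ℝ} (hg : 0 ≤ g) {ν : ℝ} (hν : criticalNu d g < ν) :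
    IntegrableOn (fun T => (survival d g T).toReal * Real.exp (-ν * T)) (Ioi 0) := by
  have hmeas : Measurable fun T => (survival d g T).toReal * Real.exp (-ν * T) :=
    (measurable_survival d g).ennreal_toReal.mul
      (Real.continuous_exp.comp (continuous_const.mul continuous_id)).measurable
  refine ⟨hmeas.aestronglyMeasurable, ?_⟩
  have hfin := susceptibility_lt_top_of_criticalNu_lt (d := d) hg hν
  unfold susceptibility at hfin
  show ∫⁻ T in Ioi (0:ℝ), ‖(survival d g T).toReal * Real.exp (-ν * T)‖ₑ < ∞
  refine lt_of_le_of_lt (le_of_eq ?_) hfin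
  refine setLIntegral_congr_fun measurableSet_Ioi fun T hT => ?_
  rw [Real.enorm_eq_ofReal (mul_nonneg ENNReal.toReal_nonneg (Real.exp_pos _).le),
    ENNReal.ofReal_mul ENNReal.toReal_nonneg,
    ENNReal.ofReal_toReal ((survival_le_one hg d hT).trans_lt ENNReal.one_lt_top).ne]

/-- `T e^{-ηT} ≤ η⁻¹` for `η > 0` (from `ηT ≤ e^{ηT}`). [folklore] -/
theorem mul_exp_neg_le_inv {η : ℝ} (hη : 0 < η) (T : ℝ) : T * Real.exp (-η * T) ≤ η⁻¹ := by
  have h1 : η * T ≤ Real.exp (η * T) := by linarith [Real.add_one_le_exp (η * T)]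
  rw [show -η * T = -(η * T) by ring, Real.exp_neg]
  rw [mul_inv_le_iff₀ (Real.exp_pos _), le_inv_mul_iff₀' hη] at *
  · nlinarith [Real.exp_pos (η * T)]

/-- **Differentiation under the integral**: for `g ≥ 0` and `ν > ν_c`, `ν' ↦ χ(g,ν')` (as a real
function) has derivative `-∫_{T>0} T c_T e^{-νT} dT` at `ν`.
[cite: BauerschmidtBrydgesSlade2015LogCorr, Lemma 2.1 (analyticity of the Laplace transform χ)] -/
theorem hasDerivAt_susceptibility_toReal {g : ℝ} (hg : 0 ≤ g) {ν : ℝ} (hν : criticalNu d g < ν) :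
    HasDerivAt (fun ν' => (susceptibility d g ν').toReal)
      (∫ T in Ioi (0 : ℝ), -T * ((survival d g T).toReal * Real.exp (-ν * T))) ν := by
  set ν₁ : ℝ := (criticalNu d g + ν) / 2 with hν₁
  set η : ℝ := (ν - ν₁) / 2 with hη
  have hν₁lt : criticalNu d g < ν₁ := by rw [hν₁]; linarith
  have hηpos : 0 < η := by rw [hη, hν₁]; linarith
  set h : ℝ → ℝ := fun T => (survival d g T).toReal with hh
  have hmeas_h : Measurable h := (measurable_survival d g).ennreal_toReal
  have hF_meas : ∀ ν' : ℝ, AEStronglyMeasurable (fun T => h T * Real.exp (-ν' * T))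
      (volume.restrict (Ioi 0)) := fun ν' => by
    have hm : Measurable fun T => h T * Real.exp (-ν' * T) := by fun_prop
    exact hm.aestronglyMeasurable
  have hF'_meas : AEStronglyMeasurable (fun T => -T * (h T * Real.exp (-ν * T)))
      (volume.restrict (Ioi 0)) := by
    have hm : Measurable fun T => -T * (h T * Real.exp (-ν * T)) := by fun_prop
    exact hm.aestronglyMeasurable
  have hkey := hasDerivAt_integral_of_dominated_loc_of_deriv_le
    (μ := volume.restrict (Ioi (0 : ℝ))) (x₀ := ν) (s := Metric.ball ν η)
    (F := fun ν' T => h T * Real.exp (-ν' * T))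
    (F' := fun ν' T => -T * (h T * Real.exp (-ν' * T)))
    (bound := fun T => η⁻¹ * (h T * Real.exp (-ν₁ * T)))
    (Metric.ball_mem_nhds ν hηpos) (Eventually.of_forall hF_meas)
    (integrableOn_survival_mul_exp hg hν) hF'_meas
    ?_ ((integrableOn_survival_mul_exp hg hν₁lt).const_mul η⁻¹) ?_
  · have hfun : (fun ν' => (susceptibility d g ν').toReal) =
        fun ν' => ∫ T in Ioi (0 : ℝ), h T * Real.exp (-ν' * T) :=
      funext fun ν' => susceptibility_toReal_eq_integral hg d ν'
    rw [hfun]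
    exact hkey.2
  · -- the bound `|T h e^{-ν'T}| ≤ η⁻¹ h e^{-ν₁T}` on `ball ν η`, `T > 0`
    refine (ae_restrict_mem measurableSet_Ioi).mono fun T hT ν' hν' => ?_
    have hT : 0 < T := hT
    have hh0 : 0 ≤ h T := ENNReal.toReal_nonneg
    have hν'lt : ν₁ + η < ν' := by
      have := Metric.mem_ball.1 hν'
      rw [Real.dist_eq] at this
      have h1 := (abs_lt.1 this).1
      rw [hη] at h1 ⊢
      linarith
    rw [Real.norm_eq_abs, abs_mul, abs_neg, abs_of_pos hT,
      abs_of_nonneg (mul_nonneg hh0 (Real.exp_pos _).le)]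
    have hexp : Real.exp (-ν' * T) ≤ Real.exp (-η * T) * Real.exp (-ν₁ * T) := by
      rw [← Real.exp_add]
      exact Real.exp_le_exp.2 (by nlinarith)
    calc T * (h T * Real.exp (-ν' * T)) ≤ T * (h T * (Real.exp (-η * T) * Real.exp (-ν₁ * T))) := by
          gcongr
      _ = (T * Real.exp (-η * T)) * (h T * Real.exp (-ν₁ * T)) := by ring
      _ ≤ η⁻¹ * (h T * Real.exp (-ν₁ * T)) :=
          mul_le_mul_of_nonneg_right (mul_exp_neg_le_inv hηpos T)
            (mul_nonneg hh0 (Real.exp_pos _).le)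
  · refine Eventually.of_forall fun T ν' _ => ?_
    have h1 : HasDerivAt (fun ν' : ℝ => -ν' * T) (-T) ν' := by
      simpa using ((hasDerivAt_id ν').neg.mul_const T)
    have h2 := (h1.exp).const_mul (h T)
    exact h2.congr_deriv (by ring)

/-- **`BBS2015_lem21` holds**: for `d > 0`, `g > 0` and `ν > ν_c(d,g)`, `χ(g,ν) < ∞` and
`ν ↦ χ(g,ν)` is differentiable at `ν` (the part of Lemma 2.1 of Bauerschmidt–Brydges–Slade 2015
used in §4, in its real form). [cite: BauerschmidtBrydgesSlade2015LogCorr, Lemma 2.1] -/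
theorem BBS2015_lem21_holds : BBS2015_lem21 := fun d _ _ hg _ hν =>
  ⟨susceptibility_lt_top_of_criticalNu_lt hg.le hν,
    (hasDerivAt_susceptibility_toReal (d := d) hg.le hν).differentiableAt⟩

end CTWSAW

end Literature.Barriers.CriticalPhenomena
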